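import Mathlib
import Literature.Analysis.PDE.Wave1DEnergySeminorm

/-!
# The energy seminorm of Cauchy data: homogeneity and the triangle inequality for finite sums

Analysis/PDE support file (everything proved). Complements `Wave1DEnergySeminorm.lean`
(`sqrt_energy_add_le`) for the square root of the wave energy
`E[(h,g)] = ∫_S h'² + W h² + g²` of Cauchy data on a measurable set `S` (`W ≥ 0` continuous):
* `sqrt_energy_smul` : `√E[(a h, a g)] = |a| √E[(h,g)]` (and integrability of the scaled density);
* `sqrt_energy_finset_sum_le` : for finitely many admissible data (`hᵢ ∈ C¹`, `gᵢ` continuous,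
  `hᵢ'², W hᵢ², gᵢ²` integrable on `S`) and coefficients `aᵢ`,
  `√E[(Σ aᵢhᵢ, Σ aᵢgᵢ)] ≤ Σ |aᵢ| √E[(hᵢ,gᵢ)]`, with admissibility of the combination.
Used to turn per-direction approximation of the exact far kernel data by true kernel data into
approximation of every exact kernel datum (hypothesis `happroxK` of `farUnit_absorb`; route
PhotonSphereChannels, `FixedModeChannels`, far side, stmt-FinalStateConjecture-10048). Folklore.
-/

noncomputable section

namespace Literature.Analysis.PDE

open Set MeasureTheory Finset Literature.Analysis.Approximation
open scoped _root_.Topology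

variable {W : ℝ → ℝ}

/-- **Homogeneity of the energy seminorm.** [folklore] -/
theorem sqrt_energy_smul {h g : ℝ → ℝ} (a : ℝ) (S : Set ℝ) :
    Real.sqrt (∫ x in S, (deriv (fun y => a * h y) x ^ 2 + W x * (a * h x) ^ 2 + (a * g x) ^ 2))
      = |a| * Real.sqrt (∫ x in S, (deriv h x ^ 2 + W x * h x ^ 2 + g x ^ 2)) := by
  have e : (fun x => deriv (fun y => a * h y) x ^ 2 + W x * (a * h x) ^ 2 + (a * g x) ^ 2)
      = fun x => a ^ 2 * (deriv h x ^ 2 + W x * h x ^ 2 + g x ^ 2) := by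
    funext x; rw [deriv_const_mul_field]; ring
  rw [show (∫ x in S, (deriv (fun y => a * h y) x ^ 2 + W x * (a * h x) ^ 2 + (a * g x) ^ 2))
      = ∫ x in S, a ^ 2 * (deriv h x ^ 2 + W x * h x ^ 2 + g x ^ 2) from by rw [e],
    MeasureTheory.integral_const_mul, Real.sqrt_mul (sq_nonneg a), Real.sqrt_sq_eq_abs]

/-- Scaled admissible data are admissible. [folklore] -/
theorem energy_smul_integrable {h g : ℝ → ℝ} (a : ℝ) {S : Set ℝ}
    (i₁ : IntegrableOn (fun x => deriv h x ^ 2) S) (i₂ : IntegrableOn (fun x => W x * h x ^ 2) S)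
    (i₃ : IntegrableOn (fun x => g x ^ 2) S) :
    IntegrableOn (fun x => deriv (fun y => a * h y) x ^ 2) S ∧
    IntegrableOn (fun x => W x * (a * h x) ^ 2) S ∧ IntegrableOn (fun x => (a * g x) ^ 2) S := by
  refine ⟨?_, ?_, ?_⟩
  · have : (fun x => deriv (fun y => a * h y) x ^ 2) = fun x => a ^ 2 * deriv h x ^ 2 := by
      funext x; rw [deriv_const_mul_field]; ring
    rw [this]; exact i₁.const_mul _
  · have : (fun x => W x * (a * h x) ^ 2) = fun x => a ^ 2 * (W x * h x ^ 2) := by funext x; ring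
    rw [this]; exact i₂.const_mul _
  · have : (fun x => (a * g x) ^ 2) = fun x => a ^ 2 * g x ^ 2 := by funext x; ring
    rw [this]; exact i₃.const_mul _

/-- **Triangle inequality of the energy seminorm for finite sums.** [folklore] -/
theorem sqrt_energy_finset_sum_le (hW : Continuous W) (hW0 : ∀ x, 0 ≤ W x) {ι : Type*}
    (s : Finset ι) {h g : ι → ℝ → ℝ} (a : ι → ℝ) {S : Set ℝ} (hS : MeasurableSet S)
    (hh : ∀ i ∈ s, ContDiff ℝ 1 (h i)) (hg : ∀ i ∈ s, Continuous (g i))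
    (i₁ : ∀ i ∈ s, IntegrableOn (fun x => deriv (h i) x ^ 2) S)
    (i₂ : ∀ i ∈ s, IntegrableOn (fun x => W x * h i x ^ 2) S)
    (i₃ : ∀ i ∈ s, IntegrableOn (fun x => g i x ^ 2) S) :
    ContDiff ℝ 1 (fun y => ∑ i ∈ s, a i * h i y) ∧ Continuous (fun y => ∑ i ∈ s, a i * g i y) ∧
    IntegrableOn (fun x => deriv (fun y => ∑ i ∈ s, a i * h i y) x ^ 2) S ∧
    IntegrableOn (fun x => W x * (∑ i ∈ s, a i * h i x) ^ 2) S ∧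
    IntegrableOn (fun x => (∑ i ∈ s, a i * g i x) ^ 2) S ∧
    Real.sqrt (∫ x in S, (deriv (fun y => ∑ i ∈ s, a i * h i y) x ^ 2
        + W x * (∑ i ∈ s, a i * h i x) ^ 2 + (∑ i ∈ s, a i * g i x) ^ 2))
      ≤ ∑ i ∈ s, |a i| * Real.sqrt (∫ x in S, (deriv (h i) x ^ 2 + W x * h i x ^ 2 + g i x ^ 2)) := by
  classical
  induction s using Finset.induction_on with
  | empty =>
    simp only [sum_empty]
    refine ⟨contDiff_const, continuous_const, ?_, ?_, ?_, ?_⟩ <;> simp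
  | insert b s hb ih =>
    have hh' : ∀ i ∈ s, ContDiff ℝ 1 (h i) := fun i hi => hh i (mem_insert_of_mem hi)
    have hg' : ∀ i ∈ s, Continuous (g i) := fun i hi => hg i (mem_insert_of_mem hi)
    obtain ⟨c1, c2, j1, j2, j3, hle⟩ := ih hh' hg' (fun i hi => i₁ i (mem_insert_of_mem hi))
      (fun i hi => i₂ i (mem_insert_of_mem hi)) (fun i hi => i₃ i (mem_insert_of_mem hi))
    have hb1 : ContDiff ℝ 1 (h b) := hh b (mem_insert_self b s)
    have hb2 : Continuous (g b) := hg b (mem_insert_self b s)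
    obtain ⟨k1, k2, k3⟩ := energy_smul_integrable (W := W) (a b) (i₁ b (mem_insert_self b s))
      (i₂ b (mem_insert_self b s)) (i₃ b (mem_insert_self b s))
    have hbh : ContDiff ℝ 1 fun y => a b * h b y := contDiff_const.mul hb1
    have hbg : Continuous fun y => a b * g b y := continuous_const.mul hb2
    obtain ⟨m1, hmink⟩ := sqrt_energy_add_le hW hW0 hbh c1 hbg c2 hS k1 k2 k3 j1 j2 j3
    -- rewrite the inserted sums
    have eh : (fun y => ∑ i ∈ insert b s, a i * h i y) = fun y => a b * h b y + ∑ i ∈ s, a i * h i y := by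
      funext y; rw [sum_insert hb]
    have eg : (fun y => ∑ i ∈ insert b s, a i * g i y) = fun y => a b * g b y + ∑ i ∈ s, a i * g i y := by
      funext y; rw [sum_insert hb]
    have eg' : ∀ x, ∑ i ∈ insert b s, a i * g i x = a b * g b x + ∑ i ∈ s, a i * g i x := fun x => by
      rw [sum_insert hb]
    have eh' : ∀ x, ∑ i ∈ insert b s, a i * h i x = a b * h b x + ∑ i ∈ s, a i * h i x := fun x => by
      rw [sum_insert hb]
    -- the three pieces of the inserted sum
    have hsW : Continuous fun x => Real.sqrt (W x) := Real.continuous_sqrt.comp hW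
    have hsq : ∀ x, Real.sqrt (W x) ^ 2 = W x := fun x => Real.sq_sqrt (hW0 x)
    have p1 : IntegrableOn (fun x => deriv (fun y => ∑ i ∈ insert b s, a i * h i y) x ^ 2) S := by
      rw [eh]
      have e : (fun x => deriv (fun y => a b * h b y + ∑ i ∈ s, a i * h i y) x ^ 2)
          = fun x => (deriv (fun y => a b * h b y) x + deriv (fun y => ∑ i ∈ s, a i * h i y) x) ^ 2 := by
        funext x
        rw [deriv_fun_add ((hbh.differentiable one_ne_zero) x) ((c1.differentiable one_ne_zero) x)]
      rw [e]
      exact integrableOn_add_sq (hbh.continuous_deriv le_rfl) (c1.continuous_deriv le_rfl) k1 j1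
    have p2 : IntegrableOn (fun x => W x * (∑ i ∈ insert b s, a i * h i x) ^ 2) S := by
      have e : (fun x => W x * (∑ i ∈ insert b s, a i * h i x) ^ 2)
          = fun x => (Real.sqrt (W x) * (a b * h b x) + Real.sqrt (W x) * (∑ i ∈ s, a i * h i x)) ^ 2 := by
        funext x; rw [eh' x, ← mul_add, mul_pow, hsq]
      rw [e]
      have k2' : IntegrableOn (fun x => (Real.sqrt (W x) * (a b * h b x)) ^ 2) S := by
        refine k2.congr_fun (fun x _ => ?_) hS; rw [mul_pow, hsq]
      have j2' : IntegrableOn (fun x => (Real.sqrt (W x) * (∑ i ∈ s, a i * h i x)) ^ 2) S := by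
        refine j2.congr_fun (fun x _ => ?_) hS; rw [mul_pow, hsq]
      exact integrableOn_add_sq (hsW.mul hbh.continuous) (hsW.mul c1.continuous) k2' j2'
    have p3 : IntegrableOn (fun x => (∑ i ∈ insert b s, a i * g i x) ^ 2) S := by
      have e : (fun x => (∑ i ∈ insert b s, a i * g i x) ^ 2)
          = fun x => (a b * g b x + ∑ i ∈ s, a i * g i x) ^ 2 := by funext x; rw [eg' x]
      rw [e]
      exact integrableOn_add_sq hbg c2 k3 j3
    refine ⟨by rw [eh]; exact hbh.add c1, by rw [eg]; exact hbg.add c2, p1, p2, p3, ?_⟩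
    -- the inequality
    have hfun : (fun x => deriv (fun y => ∑ i ∈ insert b s, a i * h i y) x ^ 2
        + W x * (∑ i ∈ insert b s, a i * h i x) ^ 2 + (∑ i ∈ insert b s, a i * g i x) ^ 2)
        = fun x => deriv (fun y => a b * h b y + ∑ i ∈ s, a i * h i y) x ^ 2
          + W x * (a b * h b x + ∑ i ∈ s, a i * h i x) ^ 2 + (a b * g b x + ∑ i ∈ s, a i * g i x) ^ 2 := by
      funext x; rw [eh, eh' x, eg' x]
    rw [hfun, sum_insert hb]
    refine hmink.trans ?_
    rw [sqrt_energy_smul (a b) S]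
    linarith

end Literature.Analysis.PDE
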